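import Mathlib
import Summits.Ventures.HodgeRepro2.Tier7.Target
import Summits.Ventures.HodgeRepro2.Tier7.Line3.Defs
import Summits.Ventures.HodgeRepro2.Tier7.Line1.Defs

/-!
# Tier7/Common/TwoTorus — the SHARED per-datum residual of Lines L1 and L3 under ONE name, and Line 1's residual from it

SEAT: t7-plan-2 (re-pointed by the t7-lead, STATUS.md l. 14627 (4) / l. 14639 (3) / RULING l. 14671 (1); accepted
l. 14649). Cell pub-hodge-repro2, Tier 7. Imports: Mathlib, the served `Tier7.Target` (frozen v8, sha256 6e511b88…),
the LANDED `Tier7.Line3.Defs` (p661163: `SeesawData`, `RtfConclusion`, `density`, the per-datum bridge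
`exists_translates_of`) and `Tier7.Line1.Defs` (`prodModS`, `prodModSbar`, `CommonIrred`, the per-datum bridge
`inf_ne_bot_of_common_irred` + `exists_pairing_ne_zero_of_inf_ne_bot`). No `sorry`, no axiom, no instance, NO second
copy of any statement (l. 14671 (1): a second declaration would split the statement).

WHAT THIS MODULE IS. The two live lines reach the target through ONE mathematical residual — «some cuspidal `π` of
the small group `U(W_A)` of the seesaw has a non-zero `Θ(π)`-component in some A-product AND in some B-product»
(t7-lead l. 14627 (3)). Its Lean home is `Line3.RtfConclusion D` (per datum, over the displayed interface
`Line3.SeesawData D`); this module names it `TT D` and kernel-proves that it feeds BOTH lines' per-datum bridges: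
* `commonIrred_of_TT : TT D → Line1.CommonIrred D` (NEW — Line 1's residual from the shared one: `Line3.density`
  applied to `U := P_A` and `U := P_B`; the Hecke-irreducible `Θ π` lies in both product modules and the inclusion
  `Θ π ↪ HX` is the non-zero equivariant map `W → W'` that `CommonIrred` asks for) and `inf_ne_bot_of_TT : TT D →
  P_A ⊓ P_B ≠ ⊥` (Line 1's ONE open statement `inf_ne_bot`, Skeleton e70b01dc… §8, reached directly — no (H10));
* `conclusion_of_TT : TT D → ∃ g, D.S.L2 (D.fOmegaS g) (D.fOmegaSbar g) ≠ 0` = Line 3's bridge by name, and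
* `conclusion_of_TT_via_L1`, the same conclusion through Line 1's bridge (`inf_ne_bot_of_common_irred` ∘
  `commonIrred_of_TT`, then `exists_pairing_ne_zero_of_inf_ne_bot`) — the two bridges agree on the shared residual.
Hence the CLOSE can report ONE residual `TT D = Line3.RtfConclusion D` with one kernel status (RULING (A′) l. 14651:
per-datum bridge, proof uniform in `D`, no datum in the import closure).

THE PER-DATUM TWO-SIDED TEST of `TT D` (RULING (A′) clauses, as recorded by the critics): (i) `¬ TT datumJ` —
crit-1 l. 14643, HOME/review/OBJECTION-L3-t7-crit-1.JunkProbe.lean `not_rtfConclusion_datumJ` (every A-product is 0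
in the datum of record); (ii) `Concl D → TT D` OPEN over the abstract datum — `RtfConclusion` carries no free vector
existential (pure translates only, so plan-2's `L2_unfold_of_conclusion` theorem of Line 2 does not apply) and its
constraint is `comp_act` on ALL of `HX`; derivable under `FiniteDimensional ℂ (H10 * H10)` or an equivariant
retraction (t7-L3-p1 / p2, route/t7/Line3/Pieces.lean P1 / P2); on the real `X` it is ≡ (P) (crit-2 ll. 14625 /
14634, accepted by the lead l. 14639 (4)); (iii) non-vacuity: t7-x1's `datumA` (l. 14651 (B); `rtfConclusion_datumA`
with `Rep := Unit`, plan-3 l. 14666 (3)). By `commonIrred_of_TT`, clause (ii) for Line 1's residual is at least as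
strong as for `TT`: any derivation `Concl D → TT D` yields `Concl D → CommonIrred D`.

Uses an L-value-free non-vanishing device: NO — this module is glue; it consumes the `SeesawData` Prop fields
(printed facts: Matsushima / Borel–Wallach VII Thm 3.2, Howe duality + (H10)), the frozen fields `hr_pos` (H4),
`H20_multone` (H10) through Line 1's bridge, and the action / conjugation axioms of the datum; it proves nothing
about the real `X` beyond these. The device (the two-torus RTF + GQT + the seesaw) is the content of `TT D`
itself (route/t7/Line3/L3-ARGUMENT.md; sharpenings route/t7/Line2/L2-TO-L3-NOTES.md) and of Line 1's transport
(route/t7/Line1/LEMMAS.md).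
-/

namespace Summit.Ventures.HodgeRepro2.Tier7

open Summit.Ventures.HodgeRepro2.T6

noncomputable section

namespace Common

variable {K : Type} [Field K] [NumberField K] {E' : Type} [Field E'] [NumberField E']
  {V : Type} [AddCommGroup V] [Module E' V] {HX : Type} [Ring HX] [Algebra ℂ HX]
  {G : Type} [Group G] [MulAction G HX] (D : PeriodDatum K E' V HX G)

/-- **THE SHARED RESIDUAL `TT(D)`** — the Common name of `Line3.RtfConclusion D` (l. 14671 (1)): some cuspidal
`π ⊂ L²([U(W_A)])` has a non-zero `Θ(π)`-component in SOME A-product and in SOME B-product. -/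
abbrev TT : Prop := Line3.RtfConclusion D

/-- Line 1's `P_A` and Line 3's `𝒟_A` are the same submodule (both `span ℂ (range D.fOmegaS)`). -/
theorem prodModS_eq_DA : Line1.prodModS D = Line3.DA D := rfl

/-- Line 1's `P_B` and Line 3's `𝒟_B` are the same submodule (both `span ℂ (range D.fOmegaSbar)`). -/
theorem prodModSbar_eq_DB : Line1.prodModSbar D = Line3.DB D := rfl

/-- In the shared residual the carrier `Θ π` is non-zero (it contains a non-zero component). -/
theorem theta_ne_bot_of_comp_ne_zero (sw : Line3.SeesawData D) (π : sw.Rep) (x : HX)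
    (hx : sw.comp π x ≠ 0) : sw.Θ π ≠ ⊥ := by
  intro hbot
  have := sw.comp_mem π x
  rw [hbot, Submodule.mem_bot] at this
  exact hx this

/-- **BRIDGE TT → Line 1's residual (NEW).** Take `W = W' = Θ π` (Hecke-irreducible by `Θ_irred`, inside `P_A`
and `P_B` by `Line3.density` applied twice) and `φ` = the inclusion `Θ π ↪ HX`, Hecke-equivariant by definition
and non-zero because `Θ π ≠ ⊥`. Consumes only the `SeesawData` Prop fields and the Hecke-stability of `P_A`, `P_B`. -/
theorem commonIrred_of_TT (h : TT D) : Line1.CommonIrred D := by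
  obtain ⟨sw, π, ⟨gA, hgA⟩, ⟨gB, hgB⟩⟩ := h
  have hne : sw.Θ π ≠ ⊥ := theta_ne_bot_of_comp_ne_zero D sw π _ hgA
  have hirr : HeckeIrred G (sw.Θ π) := sw.Θ_irred π hne
  have hA : sw.Θ π ≤ Line1.prodModS D := by
    rw [prodModS_eq_DA]
    exact Line3.density D sw π (Line3.DA D) (Line3.DA_le D) (Line3.DA_stable D)
      ⟨_, Submodule.subset_span ⟨gA, rfl⟩, hgA⟩
  have hB : sw.Θ π ≤ Line1.prodModSbar D := by
    rw [prodModSbar_eq_DB]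
    exact Line3.density D sw π (Line3.DB D) (Line3.DB_le D) (Line3.DB_stable D)
      ⟨_, Submodule.subset_span ⟨gB, rfl⟩, hgB⟩
  refine ⟨sw.Θ π, sw.Θ π, hirr, hirr, hA, hB, (sw.Θ π).subtype, fun x => x.2, fun g x => rfl, ?_⟩
  intro h0
  obtain ⟨v, hvW, hv⟩ := (Submodule.ne_bot_iff _).mp hne
  have h1 : (sw.Θ π).subtype ⟨v, hvW⟩ = 0 := by rw [h0]; rfl
  exact hv h1

/-- The same statement under Line 3's name (for the provers of the probe `Concl D → RtfConclusion D`). -/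
theorem commonIrred_of_rtfConclusion (h : Line3.RtfConclusion D) : Line1.CommonIrred D :=
  commonIrred_of_TT D h

/-- **BRIDGE TT → Line 1's one open statement `inf_ne_bot` (route/t7/Line1/Skeleton.lean e70b01dc… §8), directly:**
`Θ π` is a non-zero subspace of `P_A ⊓ P_B` (`Line3.density` twice) — no use of (H10) `H20_multone`. -/
theorem inf_ne_bot_of_TT (h : TT D) : Line1.prodModS D ⊓ Line1.prodModSbar D ≠ ⊥ := by
  obtain ⟨sw, π, ⟨gA, hgA⟩, ⟨gB, hgB⟩⟩ := h
  have hne : sw.Θ π ≠ ⊥ := theta_ne_bot_of_comp_ne_zero D sw π _ hgA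
  have hA : sw.Θ π ≤ Line3.DA D :=
    Line3.density D sw π (Line3.DA D) (Line3.DA_le D) (Line3.DA_stable D)
      ⟨_, Submodule.subset_span ⟨gA, rfl⟩, hgA⟩
  have hB : sw.Θ π ≤ Line3.DB D :=
    Line3.density D sw π (Line3.DB D) (Line3.DB_le D) (Line3.DB_stable D)
      ⟨_, Submodule.subset_span ⟨gB, rfl⟩, hgB⟩
  intro hbot
  apply hne
  rw [← le_bot_iff, ← hbot, prodModS_eq_DA, prodModSbar_eq_DB]
  exact le_inf hA hB

/-- **The per-datum conclusion from the shared residual, through Line 3's bridge** (`Line3.exists_translates_of`,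
CLEARED line by line by crit-1 l. 14643 and crit-2 l. 14634). -/
theorem conclusion_of_TT (h : TT D) : ∃ g : Fin 4 → G, D.S.L2 (D.fOmegaS g) (D.fOmegaSbar g) ≠ 0 :=
  Line3.exists_translates_of D h

/-- **The same conclusion through Line 1's bridge** (`inf_ne_bot_of_common_irred` uses (H10) `H20_multone`,
`exists_pairing_ne_zero_of_inf_ne_bot` uses (H4) `hr_pos`): the two lines' bridges agree on the shared residual. -/
theorem conclusion_of_TT_via_L1 (h : TT D) : ∃ g : Fin 4 → G, D.S.L2 (D.fOmegaS g) (D.fOmegaSbar g) ≠ 0 :=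
  Line1.exists_pairing_ne_zero_of_inf_ne_bot D (Line1.inf_ne_bot_of_common_irred D (commonIrred_of_TT D h))

/-- Line 1's residual is at least as strong as the shared one in the sense of clause (ii): every derivation of
`TT D` from a hypothesis `P` gives a derivation of `CommonIrred D` from `P` (stated for the probe's use). -/
theorem commonIrred_of_imp_TT {P : Prop} (hP : P → TT D) : P → Line1.CommonIrred D :=
  fun hp => commonIrred_of_TT D (hP hp)

end Common

end

end Summit.Ventures.HodgeRepro2.Tier7
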